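import Summits.ResolutionOfSingularities.ResolutionOfSingularities.Theorems.EquisingularLiftEquisingularLiftNatPointExit
import Summits.ResolutionOfSingularities.ResolutionOfSingularities.Theorems.EquisingularLiftEquisingularLiftNatFirstTouch
import HarnessLib

/-!
# [OURS] THE NON-CLOSED OBSTRUCTION: a stage whose reduced strict transform has a NON-CLOSED non-regular point (a singular CURVE) is never
# point-resolvable — `¬ PtResolvable F₀ T₀` — the negative half of the depth programme's residual «isolated but not absolutely isolated»
# (cruxes `Theses.EquisingularLift.EquisingularLiftNat` / `…NatThree`, stmt-ResolutionOfSingularities-20038 / -20148)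

[OURS · leafhand-res-equisingularlift-11 g0, 2026-08-31; cell `pub/decomp-res`] AI-produced, weaker than expert review; NOT a statement of any manuscript;
nothing here proves resolution of singularities in positive characteristic.  DEF-FREE helper; no `sorry`; standard axioms; ZERO named hypotheses.

The lead's hypothesis #7 of the isolated residual is `¬ IsoHypPoint k n H ι`, i.e. `¬ PointResolvable` = `¬ PtResolvable ℙⁿ_k (range ι)`
(✓ `pointResolvable_iff_ptResolvable`, ✓ `isoHypPoint_iff_pointResolvable`): NO finite chain of blow-ups of the ambient at non-regular CLOSED points of
the current reduced strict transform ends with a regular one.  The positive theory (leafhand-10: finite depth ⟹ `IsoHypPoint`) is in the tree; this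
file proves the first NEGATIVE statement in the same currency — the formal reason a point chain is stuck once a singular curve appears (e.g. two point
blow-ups into `x² + y³ + z⁷`):

* ★★★ `not_ptResolvable_of_not_isClosed` — `F₀` locally Noetherian, `T₀ ⊆ F₀` closed; if the reduced closed subscheme `V(T₀)_red` has a non-regular point `ξ` whose image in `F₀`
  is NOT a closed point, then `¬ PtResolvable F₀ T₀`.  Proof: run the chain's induction principle on the invariant «`T₁` is closed and `V(closure T₁)_red`
  has a non-regular point IN `T₁` with non-closed image»: a step blows up a CLOSED point `c`, so the invariant point lies off the centre, survives as a
  non-regular point of the next reduced strict transform (✓ `nonregular_point_persists`: the blow-up is an isomorphism off `c`, GW I 13.91 (3), and the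
  reduced strict transforms agree there, ✓ `stub_reducedStalkOverIso`), and its image stays non-closed because blow-ups are proper, hence closed maps;
  at the end the invariant contradicts regularity.
* ★ `not_ptResolvable_of_not_isClosed'` — the same with the non-regular point given as a point `y ∈ T₀` of the ambient together with a non-regular point
  of `V(T₀)_red` over it.

Honest label: closes no registered stub; it is the OBSTRUCTION half — to place a given `H` in the residual one still has to drive its (forced) point chain
to a stage with a singular curve, which needs the scheme-side chart bridge (see the census of this hand).

References: [GortzWedhorn2020, Prop. 13.91 (3)]; [Hartshorne1977, II Thm. 4.9 (proper ⟹ closed)]; [Lipman1969, §24 (absolutely isolated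
singularities)]; through the cited tree files.
-/

set_option linter.dupNamespace false -- mandated namespace `Summit.<Summit>.<Problem>` of this single-conjunct summit

noncomputable section

open CategoryTheory CategoryTheory.Limits AlgebraicGeometry TopologicalSpace Topology
open Literature.AlgebraicGeometry.Resolution
open AlgebraicGeometry.Scheme.IdealSheafData
open Summit.ResolutionOfSingularities.ResolutionOfSingularities.Theorems.EquisingularLiftNatPointExit

namespace Summit.ResolutionOfSingularities.ResolutionOfSingularities.Cruxes.EquisingularLiftNat.Sections

/-- ★★★ **THE NON-CLOSED OBSTRUCTION.**  `T₀ ⊆ F₀` closed; `ξ` a NON-REGULAR point of the reduced closed subscheme `V(T₀)_red` whose image in `F₀` is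
NOT a closed point (e.g. the generic point of a singular curve).  Then `¬ PtResolvable F₀ T₀`: no finite chain of blow-ups at non-regular closed points
of the successive reduced strict transforms reaches a regular one. [OURS] [cite: GortzWedhorn2020, Prop. 13.91 (3)] [cite: Hartshorne1977, II Thm. 4.9] -/
theorem not_ptResolvable_of_not_isClosed (F₀ : Scheme.{0}) [IsLocallyNoetherian F₀] (T₀ : Set F₀) (hT₀ : IsClosed T₀)
    (ξ : ↥(vanishingIdeal (⟨closure T₀, isClosed_closure⟩ : Closeds F₀)).subscheme)
    (hξreg : ¬ IsRegularLocalRing ((vanishingIdeal (⟨closure T₀, isClosed_closure⟩ : Closeds F₀)).subscheme.presheaf.stalk ξ))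
    (hξcl : ¬ IsClosed ({((vanishingIdeal (⟨closure T₀, isClosed_closure⟩ : Closeds F₀)).subschemeι ξ : F₀)} : Set F₀)) :
    ¬ PtResolvable F₀ T₀ := by
  rintro ⟨F', ρ', T', hind, hreg'⟩
  -- the invariant
  have key := hind (fun F₁ _ T₁ => IsLocallyNoetherian F₁ ∧ IsClosed T₁ ∧
      ∃ w : ↥(vanishingIdeal (⟨closure T₁, isClosed_closure⟩ : Closeds F₁)).subscheme,
        ((vanishingIdeal (⟨closure T₁, isClosed_closure⟩ : Closeds F₁)).subschemeι w : F₁) ∈ T₁ ∧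
        ¬ IsRegularLocalRing ((vanishingIdeal (⟨closure T₁, isClosed_closure⟩ : Closeds F₁)).subscheme.presheaf.stalk w) ∧
        ¬ IsClosed ({((vanishingIdeal (⟨closure T₁, isClosed_closure⟩ : Closeds F₁)).subschemeι w : F₁)} : Set F₁)) ?_ ?_
  · obtain ⟨-, -, w, -, hw, -⟩ := key
    exact hw (hreg' w)
  · -- base
    refine ⟨inferInstance, hT₀, ξ, ?_, hξreg, hξcl⟩
    have h : ((vanishingIdeal (⟨closure T₀, isClosed_closure⟩ : Closeds F₀)).subschemeι ξ : F₀) ∈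
        ((⟨closure T₀, isClosed_closure⟩ : Closeds F₀) : Set F₀) := by
      rw [← ComponentGluing.range_subschemeι_vanishingIdeal]; exact ⟨ξ, rfl⟩
    have h' : ((vanishingIdeal (⟨closure T₀, isClosed_closure⟩ : Closeds F₀)).subschemeι ξ : F₀) ∈ closure T₀ := h
    exact (hT₀.closure_subset_iff.mpr subset_rfl) h'
  · -- step: blow up the closed non-regular point `x`; the invariant point `w` lies off the centre and survives
    intro F₁ F₂ ρ T₁ x υ hx hQ hxreg hυ
    obtain ⟨hF₁, hT₁, w, hwT, hwreg, hwcl⟩ := hQ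
    haveI : IsLocallyNoetherian F₁ := hF₁
    haveI : IsProper υ := hυ.isProper
    haveI : IsLocallyNoetherian F₂ := LocallyOfFiniteType.isLocallyNoetherian υ
    have hC : (((vanishingIdeal (⟨{((vanishingIdeal (⟨closure T₁, isClosed_closure⟩ : Closeds F₁)).subschemeι x : F₁)}, hx⟩ :
        Closeds F₁)).support : Set F₁)) =
        {((vanishingIdeal (⟨closure T₁, isClosed_closure⟩ : Closeds F₁)).subschemeι x : F₁)} :=
      Scheme.IdealSheafData.coe_support_vanishingIdeal _
    have hwc : ((vanishingIdeal (⟨closure T₁, isClosed_closure⟩ : Closeds F₁)).subschemeι w : F₁) ∉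
        (((vanishingIdeal (⟨{((vanishingIdeal (⟨closure T₁, isClosed_closure⟩ : Closeds F₁)).subschemeι x : F₁)}, hx⟩ :
          Closeds F₁)).support : Set F₁)) := by
      rw [hC, Set.mem_singleton_iff]
      intro h
      exact hwcl (by rw [h]; exact hx)
    have eng := nonregular_point_persists υ _ hυ T₁ hwT hwc w rfl hwreg
    rw [hC] at eng
    obtain ⟨x'', hx'', hmem, z, hz, hzreg⟩ := eng
    refine ⟨inferInstance, isClosed_closure, z, ?_, hzreg, ?_⟩
    · rw [hz]; exact hmem
    · rw [hz]
      intro hcl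
      apply hwcl
      have h := υ.isClosedMap _ hcl
      rwa [Set.image_singleton, hx''] at h

/-- ★ **The same, with the non-regular point given downstairs**: `y ∈ T₀` a point of the ambient whose closure is not a point, and a non-regular point of
`V(T₀)_red` over it. [OURS] [cite: GortzWedhorn2020, Prop. 13.91 (3)] -/
theorem not_ptResolvable_of_not_isClosed' (F₀ : Scheme.{0}) [IsLocallyNoetherian F₀] (T₀ : Set F₀) (hT₀ : IsClosed T₀) {y : F₀}
    (hycl : ¬ IsClosed ({y} : Set F₀))
    (hy : ∃ w : ↥(vanishingIdeal (⟨closure T₀, isClosed_closure⟩ : Closeds F₀)).subscheme,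
      ((vanishingIdeal (⟨closure T₀, isClosed_closure⟩ : Closeds F₀)).subschemeι w : F₀) = y ∧
      ¬ IsRegularLocalRing ((vanishingIdeal (⟨closure T₀, isClosed_closure⟩ : Closeds F₀)).subscheme.presheaf.stalk w)) :
    ¬ PtResolvable F₀ T₀ := by
  obtain ⟨w, hw, hwreg⟩ := hy
  exact not_ptResolvable_of_not_isClosed F₀ T₀ hT₀ w hwreg (by rw [hw]; exact hycl)

end Summit.ResolutionOfSingularities.ResolutionOfSingularities.Cruxes.EquisingularLiftNat.Sections

end
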